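import Summits.MatrixMultiplication.MatrixMultiplication.Theorems.OutsiderSandwichContactFace
/-!
# OutsiderSandwich — the PRICE OF A CELL: what finite certificates do to the extremal counterexample

Route `route-MatrixMultiplication-OutsiderSandwich` (decomp-mm lens 4, generation 15); sequel to
`OutsiderSandwichContactFace` (notation there: `τ_F`, `x_F`, the laser floor `Λ`, the contact face
`T = touchingExponents`, `τ* = sSup T`).  Cut of record unchanged.

§1 THE PRICE OF A CELL (what finite certificates can and cannot do).  An (assisted, multi-block)
   cell `⟨B⟩ ⊠ ⟨m,m,m⟩ ≤ cw₂^{⊠N} ⊠ ⟨r⟩` with block side beyond the laser wall (`log₂ m > N/3`)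
   evaluates at a touching point to `log₂B + τ log₂m ≤ log₂r + N·Λ(τ)`, i.e.
     `τ ≤ price(N,B,m,r) := (N(log₂3 − 2/3) + log₂ r − log₂ B) / (log₂ m − N/3)`
   for EVERY touching exponent (`touching_le_cellPrice`), so `τ* ≤ price` and `T ⊆ [2, price]`
   (`sSup_touchingExponents_le_cellPrice`, `touchingExponents_subset_Icc_of_cell`); under the residual
   crux `ω ≤ price` (`omega_le_cellPrice_of_laserMergeOptimal`); and cells of price `→ 2⁺` prove the
   attacked crux (`laserTangency_of_cheap_cells`).  Every instrument of the node is a cell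
   (I(N,m): B = r = 1; assisted cells: B = 1; capped packings / LNT: r = 1), so ONE number per census
   row — its price — is a certified upper bound on the height `τ*` of the extremal counterexample;
   a row with price `< 2.3729` (the tree's `ω̄`) would be new.  A cell shrinks `T` only FROM ABOVE:
   it is silent on `(2, price)`, so finitely many cells never certify `CornerIsolation` without
   certifying the tail of `LaserTangency` — the local piece is exactly what cells cannot see.

References: Strassen, J. reine angew. Math. 384 (1988) Thm. 2.3–2.4, 3.8; Strassen, J. reine angew.
Math. 413 (1991) §6; Christandl–Vrana–Zuiddam, J. AMS 36 (2023) Prop. 1.6, Cor. 3.31, Thm. 4.20;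
Coppersmith–Winograd, JSC 9 (1990) §6–7; Bürgisser–Clausen–Shokrollahi (1997) 15.3, 15.41;
Alman–Li–Pratt, arXiv:2604.01386 §8 (edges of the matrix-multiplication spectrum).
-/

-- the problem's namespace `Summit.MatrixMultiplication.MatrixMultiplication` repeats the summit name
set_option linter.dupNamespace false

namespace Summit.MatrixMultiplication.MatrixMultiplication.Theorems.OutsiderSandwichCellPrice

open scoped Topology
open Filter
open Literature.Computability.AlgebraicComplexity
open Literature.Barriers.MatrixMultiplication (flatteningRank_cwTensor)
open Summit.MatrixMultiplication.MatrixMultiplication.Theses.OutsiderSandwich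
open Summit.MatrixMultiplication.MatrixMultiplication.Theorems.OutsiderSandwichLaserFloor
  (one_le_map_matMulTensor two_le_matExp laserFloor rpow_matExp_le_map_matMulTensor)
open Summit.MatrixMultiplication.MatrixMultiplication.Theorems.OutsiderSandwichLaserFloorCut
  (matExp_le_omega three_le_map_cwTensor)
open Summit.MatrixMultiplication.MatrixMultiplication.Theorems.OutsiderSandwichSpectralTransfer
  (map_unitTensor)
open Summit.MatrixMultiplication.MatrixMultiplication.Theorems.OutsiderSandwichPackingProfileLaser
  (perfectBeyondLaser_of_cwTwoMMPerfect)
open Summit.MatrixMultiplication.MatrixMultiplication.Theorems.OutsiderSandwichLaserTangency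
  (laserTangency_of_summit)
open Summit.MatrixMultiplication.MatrixMultiplication.Theorems.OutsiderSandwichTouchingExponent
  (touchingExponents touchingExponents_subset_Icc bddAbove_touchingExponents
    isCompact_touchingExponents two_mem_touchingExponents_of laserTangency_iff_subset_two
    laserMergeOptimal_iff_omega_mem laserTangency_iff_sSup_le laserMergeOptimal_iff_sSup_eq
    sSup_touchingExponents_le_omega)

variable {F : SpectralMap ℂ}
open Summit.MatrixMultiplication.MatrixMultiplication.Theorems.OutsiderSandwichContactFace

/-! ## §1  The price of a cell -/

/-- The **price** of an assisted multi-block cell `⟨B⟩ ⊠ ⟨m,m,m⟩ ≤ cw₂^{⊠N} ⊠ ⟨r⟩` with block side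
beyond the laser wall (`log₂ m > N/3`): `(N(log₂3 − 2/3) + log₂ r − log₂ B) / (log₂ m − N/3)`
— the largest height at which the floor line is compatible with the cell. -/
noncomputable def cellPrice (N B m r : ℕ) : ℝ :=
  ((N : ℝ) * (Real.logb 2 3 - 2 / 3) + Real.logb 2 r - Real.logb 2 B) / (Real.logb 2 m - N / 3)

/-- **A universal point applied to an assisted cell**: `B · m^{τ_F} ≤ r · F(cw₂)^N`.
[cite: Strassen1988, Thm. 3.8] -/
theorem mul_rpow_le_of_cell (hF : IsUniversalSpectralPoint ℂ F) {N B m r : ℕ} (hm : 1 ≤ m)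
    (hcell : TensorRestrictsTo (kroneckerTensor (kroneckerPow (cwTensor ℂ 2) N) (unitTensor ℂ r))
      (kroneckerTensor (unitTensor ℂ B) (matMulTensor ℂ m m m))) :
    (B : ℝ) * (m : ℝ) ^ Real.logb 2 (F (matMulTensor ℂ 2 2 2)) ≤ (r : ℝ) * F (cwTensor ℂ 2) ^ N := by
  have h := hF.mono _ _ hcell
  rw [hF.map_kronecker, hF.map_kronecker, map_unitTensor hF, map_unitTensor hF,
    hF.map_kroneckerPow] at h
  calc (B : ℝ) * (m : ℝ) ^ Real.logb 2 (F (matMulTensor ℂ 2 2 2))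
      ≤ (B : ℝ) * F (matMulTensor ℂ m m m) :=
        mul_le_mul_of_nonneg_left (rpow_matExp_le_map_matMulTensor hF hm) (Nat.cast_nonneg B)
    _ ≤ F (cwTensor ℂ 2) ^ N * (r : ℝ) := h
    _ = (r : ℝ) * F (cwTensor ℂ 2) ^ N := mul_comm _ _

/-- The cell in logarithms: `log₂ B + τ_F · log₂ m ≤ log₂ r + N · x_F`. [cite: Strassen1988, Thm. 3.8] -/
theorem logb_cell_le (hF : IsUniversalSpectralPoint ℂ F) {N B m r : ℕ} (hB : 1 ≤ B) (hm : 1 ≤ m)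
    (hr : 1 ≤ r)
    (hcell : TensorRestrictsTo (kroneckerTensor (kroneckerPow (cwTensor ℂ 2) N) (unitTensor ℂ r))
      (kroneckerTensor (unitTensor ℂ B) (matMulTensor ℂ m m m))) :
    Real.logb 2 B + Real.logb 2 (F (matMulTensor ℂ 2 2 2)) * Real.logb 2 m ≤
      Real.logb 2 r + N * Real.logb 2 (F (cwTensor ℂ 2)) := by
  have h := mul_rpow_le_of_cell hF hm hcell
  have hB0 : (0 : ℝ) < B := by exact_mod_cast hB
  have hm0 : (0 : ℝ) < m := by exact_mod_cast hm
  have hr0 : (0 : ℝ) < r := by exact_mod_cast hr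
  have hcw0 : 0 < F (cwTensor ℂ 2) := lt_of_lt_of_le (by norm_num) (three_le_map_cwTensor hF)
  have h1 := Real.logb_le_logb_of_le (b := 2) one_lt_two (by positivity) h
  rw [Real.logb_mul hB0.ne' (Real.rpow_pos_of_pos hm0 _).ne', Real.logb_rpow_eq_mul_logb_of_pos hm0,
    Real.logb_mul hr0.ne' (pow_pos hcw0 N).ne', Real.logb_pow] at h1
  exact h1

/-- **Price bound.**  Every touching exponent is at most the price of every cell whose block side is
beyond the laser wall: `t ≤ price(N,B,m,r)` for all `t ∈ T`.  (At a touching point `x_F = Λ(τ_F)`, so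
`log₂B + τ log₂m ≤ log₂r + N(log₂3 − 2/3) + Nτ/3`.) [cite: Strassen1988, Thm. 2.3, 3.8] -/
theorem touching_le_cellPrice {N B m r : ℕ} (hB : 1 ≤ B) (hm : 1 ≤ m) (hr : 1 ≤ r)
    (hwall : (N : ℝ) / 3 < Real.logb 2 m)
    (hcell : TensorRestrictsTo (kroneckerTensor (kroneckerPow (cwTensor ℂ 2) N) (unitTensor ℂ r))
      (kroneckerTensor (unitTensor ℂ B) (matMulTensor ℂ m m m)))
    {t : ℝ} (ht : t ∈ touchingExponents) : t ≤ cellPrice N B m r := by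
  obtain ⟨G, hG, rfl, hGx⟩ := ht
  have hlog := logb_cell_le hG hB hm hr hcell
  rw [hGx] at hlog
  unfold cellPrice
  rw [le_div_iff₀ (by linarith)]
  linear_combination hlog

/-- **`τ* ≤ price`**: the height of the extremal counterexample is at most the price of every cell
beyond the laser wall. [cite: Strassen1988, Thm. 2.3, 3.8] -/
theorem sSup_touchingExponents_le_cellPrice {N B m r : ℕ} (hB : 1 ≤ B) (hm : 1 ≤ m) (hr : 1 ≤ r)
    (hwall : (N : ℝ) / 3 < Real.logb 2 m)
    (hcell : TensorRestrictsTo (kroneckerTensor (kroneckerPow (cwTensor ℂ 2) N) (unitTensor ℂ r))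
      (kroneckerTensor (unitTensor ℂ B) (matMulTensor ℂ m m m))) :
    sSup touchingExponents ≤ cellPrice N B m r :=
  csSup_le touchingExponents_nonempty fun _ ht => touching_le_cellPrice hB hm hr hwall hcell ht

/-- A cell shrinks the contact face FROM ABOVE only: `T ⊆ [2, price]` (it is silent on
`(2, price)`). [cite: Strassen1988, Thm. 2.3, 3.8] -/
theorem touchingExponents_subset_Icc_of_cell {N B m r : ℕ} (hB : 1 ≤ B) (hm : 1 ≤ m) (hr : 1 ≤ r)
    (hwall : (N : ℝ) / 3 < Real.logb 2 m)
    (hcell : TensorRestrictsTo (kroneckerTensor (kroneckerPow (cwTensor ℂ 2) N) (unitTensor ℂ r))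
      (kroneckerTensor (unitTensor ℂ B) (matMulTensor ℂ m m m))) :
    touchingExponents ⊆ Set.Icc 2 (cellPrice N B m r) :=
  fun _ ht => ⟨(touchingExponents_subset_Icc ht).1, touching_le_cellPrice hB hm hr hwall hcell ht⟩

/-- **`2 ≤ price`** for every cell beyond the wall (the corner touches). [cite: Strassen1988, Thm. 2.3] -/
theorem two_le_cellPrice {N B m r : ℕ} (hB : 1 ≤ B) (hm : 1 ≤ m) (hr : 1 ≤ r)
    (hwall : (N : ℝ) / 3 < Real.logb 2 m)
    (hcell : TensorRestrictsTo (kroneckerTensor (kroneckerPow (cwTensor ℂ 2) N) (unitTensor ℂ r))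
      (kroneckerTensor (unitTensor ℂ B) (matMulTensor ℂ m m m))) :
    2 ≤ cellPrice N B m r :=
  touching_le_cellPrice hB hm hr hwall hcell two_mem_touchingExponents

/-- **Under the residual crux, `ω ≤ price`**: `LaserMergeOptimal` puts `ω ∈ T`, so every cell beyond
the wall bounds `ω` (the price reading of g10's `omega_le_of_laserTangencyAt`).
[cite: Strassen1988, Thm. 2.4, 3.8] -/
theorem omega_le_cellPrice_of_laserMergeOptimal (hB2 : LaserMergeOptimal) {N B m r : ℕ} (hB : 1 ≤ B)
    (hm : 1 ≤ m) (hr : 1 ≤ r) (hwall : (N : ℝ) / 3 < Real.logb 2 m)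
    (hcell : TensorRestrictsTo (kroneckerTensor (kroneckerPow (cwTensor ℂ 2) N) (unitTensor ℂ r))
      (kroneckerTensor (unitTensor ℂ B) (matMulTensor ℂ m m m))) :
    omega ℂ ≤ cellPrice N B m r :=
  touching_le_cellPrice hB hm hr hwall hcell (laserMergeOptimal_iff_omega_mem.1 hB2)

/-- **Cheap cells prove the attacked crux**: if for every `η > 0` some cell beyond the laser wall has
price `≤ 2 + η`, then `LaserTangency`. [cite: Strassen1988, Thm. 2.3, 3.8] -/
theorem laserTangency_of_cheap_cells
    (h : ∀ η : ℝ, 0 < η → ∃ N B m r : ℕ, 1 ≤ B ∧ 1 ≤ m ∧ 1 ≤ r ∧ (N : ℝ) / 3 < Real.logb 2 m ∧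
      TensorRestrictsTo (kroneckerTensor (kroneckerPow (cwTensor ℂ 2) N) (unitTensor ℂ r))
        (kroneckerTensor (unitTensor ℂ B) (matMulTensor ℂ m m m)) ∧
      cellPrice N B m r ≤ 2 + η) :
    LaserTangency := by
  rw [laserTangency_iff_subset_two]
  intro t ht
  rw [Set.mem_singleton_iff]
  refine le_antisymm (le_of_forall_pos_le_add fun η hη => ?_) (touchingExponents_subset_Icc ht).1
  obtain ⟨N, B, m, r, hB, hm, hr, hwall, hcell, hp⟩ := h η hη
  exact (touching_le_cellPrice hB hm hr hwall hcell ht).trans hp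

/-- **The price bound, letter of the route item `CellPriceBound`** (everything spelled out): for every
assisted multi-block cell `⟨B⟩ ⊠ ⟨m,m,m⟩ ≤ cw₂^{⊠N} ⊠ ⟨r⟩` with `log₂ m > N/3` and every universal
spectral point ON the laser floor, `τ_F · (log₂ m − N/3) ≤ N(log₂3 − 2/3) + log₂ r − log₂ B`.
[cite: Strassen1988, Thm. 2.3, 3.8] -/
theorem cellPriceBound :
    ∀ N B m r : ℕ, 1 ≤ B → 1 ≤ m → 1 ≤ r →
      TensorRestrictsTo (kroneckerTensor (kroneckerPow (cwTensor ℂ 2) N) (unitTensor ℂ r))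
        (kroneckerTensor (unitTensor ℂ B) (matMulTensor ℂ m m m)) →
      ∀ F : SpectralMap ℂ, IsUniversalSpectralPoint ℂ F →
        Real.logb 2 (F (cwTensor ℂ 2)) =
          Real.logb 2 3 + (Real.logb 2 (F (matMulTensor ℂ 2 2 2)) - 2) / 3 →
        Real.logb 2 (F (matMulTensor ℂ 2 2 2)) * (Real.logb 2 m - N / 3) ≤
          N * (Real.logb 2 3 - 2 / 3) + Real.logb 2 r - Real.logb 2 B := by
  intro N B m r hB hm hr hcell G hG hGx
  have hlog := logb_cell_le hG hB hm hr hcell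
  rw [hGx] at hlog
  linear_combination hlog

/-! ## §2  By-name link to the route item (rev 19) -/

/-- closes item stmt-MatrixMultiplication-27973 `CellPriceBound`. [cite: Strassen1988, Thm. 2.3, 3.8] -/
theorem cellPriceBound_holds : CellPriceBound := cellPriceBound

end Summit.MatrixMultiplication.MatrixMultiplication.Theorems.OutsiderSandwichCellPrice
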